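import Literature.AlgebraicGeometry.AbelianSchemes.AbelianSchemeDualPairBaseChange
import HarnessLib

/-!
# A rigidified line bundle on `A_T` over `T → S' → S` IS one on `(A_{S'})_T` (the converse of ★ `RigidifiedLineBundle.alongBaseChange`)

Layer `Literature/AlgebraicGeometry/AbelianSchemes`, namespace `Literature.AlgebraicGeometry.AbelianSchemes.AbelianSchemeOver.RigidifiedLineBundle`.
One definition with body (`toBaseChange`, transport of DATA along the group-scheme isomorphism `(A_{S'})_{f'} ≅ A_{f' ≫ g}` of ★
`AbelianSchemeBaseChangeComp.baseChangeCompGrpIso`) + theorems; no structure, no named fact, no instance, no notation, no `sorry`.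

[MilneAV2008, I §8]: the test objects of the dual («pairs `(T, ℒ)`, `ℒ` on `A × T` rigidified along `{0} × T`, fibrewise in `Pic⁰`») for
`A ×_S S'` over an `S'`-scheme `T` are the same thing as test objects for `A` over `T → S' → S` ([MumfordFogartyKirwan1994, Def. 7.2]'s
functoriality «in the obvious way»).  ★ `AbelianSchemeDualPairBaseChange` proves one direction (`alongBaseChange`: a rigidified family on
`(A_{S'})_T` is one on `A_T`); THIS FILE proves the other:

* `unitSection_comp_bcInvLeft` — the identity sections correspond under `e⁻¹ : (A_{S'})_{f'} → A_{f' ≫ g}`;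
* **`toBaseChange ℒ : (A.baseChange g).RigidifiedLineBundle f'`** for `ℒ : A.RigidifiedLineBundle (f' ≫ g)` — module `(e⁻¹)^* ℒ`, rank one,
  rigidified; `toBaseChange_L`;
* **`toBaseChange_fibrewisePicZero`** — fibrewise `Pic⁰` transfers (the fibres correspond under ★ `fibreAlongBaseChangeIso`, homogeneity moves
  along isomorphisms of abelian varieties ★ `isHomogeneous_pullback_iff_of_iso`);
* `nonempty_iso_toBaseChange_L_iff` — a module `N` on `(A_{S'})_T` is isomorphic to `(toBaseChange ℒ).L` iff `e^* N ≅ ℒ.L` (so classifying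
  statements for the base-changed dual pair ★ `DualPair.baseChange` read directly on `ℒ`).

Cell hodgecm-mathlib (D-0151), FLOOR 0 P1 sub-line `F3DualAbelianScheme` stub (Z): the transport every letter (U)(E)(F) of FILE P-b
(`B-provers/B-p06/g14/F3/DualPairOfGluedHat.SKELETON-4sorry.B-p06g14.lean`) starts with («restrict `ℒ` to `f⁻¹Uᵢ` and read it as a family for
`Aᵢ = A ×_S Uᵢ`»); also the shape (M-c) hands need.  Count-neutral; HC_CM is proved only modulo the 7 printed citations until rung 0 closes.

## References
* [MilneAV2008] J. S. Milne, *Abelian Varieties* (v2.00, 2008), I §8 pp. 36–37.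
* [MumfordFogartyKirwan1994] D. Mumford, J. Fogarty, F. Kirwan, *Geometric Invariant Theory*, 3rd ed. (1994), Ch. 7 §2 Def. 7.2 (p. 129);
  Ch. 6 §1 Cor. 6.8 (p. 118).
* [MumfordAV1970] D. Mumford, *Abelian Varieties* (1970), §8 ((iv) ⇔ (i)).
* [GortzWedhorn2020] U. Görtz, T. Wedhorn, *Algebraic Geometry I*, 2nd ed. (2020), Section (4.7) (pp. 107–108, 135).
-/

set_option autoImplicit false

-- `Scheme.Modules` / `SheafOfModules` are not reducible (as in ★ `AbelianSchemeDualPairBaseChange`).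
set_option backward.isDefEq.respectTransparency false

noncomputable section

universe u

open CategoryTheory CategoryTheory.Limits AlgebraicGeometry MonoidalCategory
open Literature.AlgebraicGeometry.Motives Literature.AlgebraicGeometry.AbelianVarieties Literature.AlgebraicGeometry.Modules

namespace Literature.AlgebraicGeometry.AbelianSchemes

namespace AbelianSchemeOver

variable {S S' T : Scheme.{u}} (A : AbelianSchemeOver S) (g : S' ⟶ S) (f' : T ⟶ S')

/-- **The identity sections correspond under `e⁻¹ : (A_{S'})_{f'} → A_{f' ≫ g}`** (inverse form of ★
`unitSection_comp_baseChangeCompGrpIso_hom_left`). [cite: GortzWedhorn2020, Section (4.7) (pp. 107–108)] -/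
@[reassoc]
theorem unitSection_comp_bcInvLeft :
    ((A.baseChange g).baseChange f').unitSection ≫ A.bcInvLeft g f' = (A.baseChange (f' ≫ g)).unitSection := by
  rw [← A.unitSection_comp_baseChangeCompGrpIso_hom_left g f', Category.assoc]
  change (A.baseChange (f' ≫ g)).unitSection ≫ (A.bcHomLeft g f' ≫ A.bcInvLeft g f') = _
  rw [A.baseChangeCompGrpIso_hom_left_inv_left g f', Category.comp_id]

namespace RigidifiedLineBundle

variable {A} {g} {f'} (ℒ : A.RigidifiedLineBundle (f' ≫ g))

/-- **A rigidified line bundle on `A_T` over `T → S' → S` IS one on `(A_{S'})_T`**: transport along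
`e⁻¹ : (A_{S'})_{f'} → A_{f' ≫ g}`; the rigidification follows the identity sections (`unitSection_comp_bcInvLeft`).
[cite: MilneAV2008, I §8 pp. 36–37] [cite: MumfordFogartyKirwan1994, Ch. 7 §2 Definition 7.2 (p. 129)] -/
def toBaseChange : (A.baseChange g).RigidifiedLineBundle f' where
  L := (Scheme.Modules.pullback (A.bcInvLeft g f')).obj ℒ.L
  hasRank_one := hasRank_pullback _ ℒ.hasRank_one
  rigid := ℒ.rigid.map fun r =>
    (Scheme.Modules.pullbackComp _ _).app ℒ.L ≪≫
      (Scheme.Modules.pullbackCongr (A.unitSection_comp_bcInvLeft g f')).app ℒ.L ≪≫ r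

/-- The module of `ℒ.toBaseChange` is `(e⁻¹)^* ℒ` (definitional). [cite: MilneAV2008, I §8 pp. 36–37] -/
theorem toBaseChange_L : ℒ.toBaseChange.L = (Scheme.Modules.pullback (A.bcInvLeft g f')).obj ℒ.L :=
  rfl

variable {ℒ} in
/-- **`ℒ.toBaseChange` is fibrewise in `Pic⁰` if `ℒ` is**: the fibres of `A_{f' ≫ g}` and `(A_{S'})_{f'}` at a geometric point `u` of `T`
correspond under ★ `fibreAlongBaseChangeIso`, along which `(fibre slice)^* (e⁻¹)^* ℒ` becomes `(fibre slice)^* ℒ`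
(`e^* (e⁻¹)^* ℒ ≅ ℒ`, ★ `pullbackHomPullbackInvIso`); homogeneity moves along isomorphisms of abelian varieties (★
`isHomogeneous_pullback_iff_of_iso`). [cite: MumfordAV1970, §8 ((iv) ⇔ (i))] [cite: MilneAV2008, I §8 pp. 36–37] -/
theorem toBaseChange_fibrewisePicZero (h : ℒ.FibrewisePicZero) : ℒ.toBaseChange.FibrewisePicZero := by
  intro Ω _ _ u
  -- along `φ : (A_{f' ≫ g})_u ≅ ((A_{S'})_{f'})_u`: homogeneity of `N` on the target ⟸ homogeneity of `φ^* N` on the source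
  refine (isHomogeneous_pullback_iff_of_iso (A.fibreAlongBaseChangeIso g f' u) _).1 ?_
  refine (isHomogeneous_iff_of_iso _ ?_).2 (h Ω u)
  -- `φ^* pr^* (e⁻¹)^* ℒ ≅ (φ ≫ pr)^* (e⁻¹)^* ℒ = (pr ≫ e)^* (e⁻¹)^* ℒ ≅ pr^* (e^* (e⁻¹)^* ℒ) ≅ pr^* ℒ`
  exact (Scheme.Modules.pullbackComp _ _).app _ ≪≫
    (Scheme.Modules.pullbackCongr (A.fibreAlongBaseChangeIso_hom_toSchemeHom_fst g f' u)).app _ ≪≫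
    ((Scheme.Modules.pullbackComp _ _).app _).symm ≪≫
    (Scheme.Modules.pullback (pullback.fst (A.baseChange (f' ≫ g)).X.hom u)).mapIso (A.pullbackHomPullbackInvIso g f' ℒ.L)

/-- **Isomorphism classes transfer along `e`**: a module `N` on `(A_{S'})_T` is isomorphic to `(ℒ.toBaseChange).L = (e⁻¹)^*ℒ` iff `e^* N ≅ ℒ`
(pull back along `e`, resp. `e⁻¹`; ★ `pullbackHomPullbackInvIso` / `pullbackInvPullbackHomIso`).  Through this, classifying statements for
the base-changed dual pair (★ `DualPair.baseChange`) are read directly on `ℒ`. [cite: MilneAV2008, I §8 pp. 36–37] -/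
theorem nonempty_iso_toBaseChange_L_iff (N : ((A.baseChange g).baseChange f').X.left.Modules) :
    Nonempty (N ≅ ℒ.toBaseChange.L) ↔ Nonempty ((Scheme.Modules.pullback (A.bcHomLeft g f')).obj N ≅ ℒ.L) := by
  constructor
  · rintro ⟨i⟩
    exact ⟨(Scheme.Modules.pullback (A.bcHomLeft g f')).mapIso i ≪≫ A.pullbackHomPullbackInvIso g f' ℒ.L⟩
  · rintro ⟨i⟩
    exact ⟨(A.pullbackInvPullbackHomIso g f' N).symm ≪≫ (Scheme.Modules.pullback (A.bcInvLeft g f')).mapIso i⟩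

/-- `(ℒ.toBaseChange).alongBaseChange` has module `e^* (e⁻¹)^* ℒ ≅ ℒ` (round trip). [cite: MilneAV2008, I §8 pp. 36–37] -/
theorem nonempty_toBaseChange_alongBaseChange_L_iso : Nonempty (ℒ.toBaseChange.alongBaseChange.L ≅ ℒ.L) :=
  ⟨A.pullbackHomPullbackInvIso g f' ℒ.L⟩

end RigidifiedLineBundle

end AbelianSchemeOver

end Literature.AlgebraicGeometry.AbelianSchemes

end
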